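import Literature.Topology.FourManifolds.ProductRefinement
import Literature.Topology.FourManifolds.CellEngulfingFromEngulfing
import HarnessLib

/-!
# Geometry of blocks and cells for the macro step of the engulfing induction

Auxiliary facts for one block `conv τ × [s a, s (a + 1)]` of the initial product structure
and the cells `conv τ' × [t' c, t' (c + 1)]` of a refinement inside it (Rushing 1973, proof of
Thm. 4.12.1, the bookkeeping of `X(k, m, a)` in the refined form of the induction; see the module
docstrings of `ProductRefinement.lean` and `MicroLoop.lean`):

* `card_le_card_image_fst_add_one_of_subset_stair`, `card_image_fst_eq_of_forall_snd_eq` — a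
  prism face has at most one vertex more than its projection, and exactly as many if it lies at
  one level;
* `exists_small_face_of_mem_prismCell_piece`, `exists_small_face_of_mem_prismLevel_piece` —
  **tracked pieces are unions of small fine faces**: a point of an initial cell `conv σ × [s a,
  s (a+1)]` with `σ.card ≤ n - 3`, resp. of an initial level `conv σ × {s a}` with
  `σ.card ≤ n - 2`, lies in a closed face of the fine product complex with at most `n - 2`
  vertices contained in the piece;
* `subLevels_comp` — equal subdivisions compose (the levels after two refinements are the equal
  subdivision of the initial levels);
* `convexHull_inter_facet_subset_walls` — an *interior* fine simplex (not inside a facet of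
  `τ`) meets a facet of `τ` inside the union of its own facets, and
  `convexHull_inter_convexHull_subset_walls` — two distinct fine simplices of the same
  cardinality meet inside the facets of either.

Everything is proved; theorems only (no definition, no named fact).

## References

* T. B. Rushing, *Topological embeddings*, Academic Press (1973), proof of Thm. 4.12.1.
  [Rushing1973]
-/

open Set Function

noncomputable section

namespace Literature.Topology.FourManifolds

open Literature.Analysis.Convexity

variable {W : Type*} [NormedAddCommGroup W] [NormedSpace ℝ W] [DecidableEq W]

/-! ### Cardinalities of prism faces -/

omit [NormedAddCommGroup W] [NormedSpace ℝ W] in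
/-- **A prism face has at most one vertex more than its projection**: a subset of a staircase
simplex of a duplicate-free list contains both copies of at most one vertex. [folklore] -/
theorem card_le_card_image_fst_add_one_of_subset_stair {u u' : ℝ} (huu' : u ≠ u') :
    ∀ (l : List W) (_ : l.Nodup) (i : ℕ) (F : Finset (W × ℝ)), F ⊆ stair u u' l i →
      F.card ≤ (F.image Prod.fst).card + 1
  | [], _, i, F, hF => by
      have : F = ∅ := by
        rw [Finset.eq_empty_iff_forall_notMem]
        intro q hq
        have := hF hq
        simp [stair] at this
      simp [this]
  | v :: rest, hnd, 0, F, hF => by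
      -- `stair 0 = insert (v, u') (bottom simplex)`: the bottom part projects injectively
      have hv : v ∉ rest := (List.nodup_cons.1 hnd).1
      rw [stair_cons_zero] at hF
      set F₀ := F.erase (liftV u' v) with hF₀
      have hF₀sub : F₀ ⊆ bottomSimplex u (v :: rest) := fun q hq => by
        have hq' := Finset.mem_erase.1 hq
        rcases Finset.mem_insert.1 (hF hq'.2) with h | h
        · exact absurd h hq'.1
        · exact h
      have hinj : Set.InjOn Prod.fst (F₀ : Set (W × ℝ)) := by
        intro q hq q' hq' h
        have h1 := snd_eq_of_mem_bottomSimplex (hF₀sub hq)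
        have h2 := snd_eq_of_mem_bottomSimplex (hF₀sub hq')
        exact Prod.ext h (h1.trans h2.symm)
      have hcard₀ : F₀.card = (F₀.image Prod.fst).card := (Finset.card_image_of_injOn hinj).symm
      have h1 : F.card ≤ F₀.card + 1 := by
        by_cases h : liftV u' v ∈ F
        · rw [hF₀, Finset.card_erase_add_one h]
        · rw [hF₀, Finset.erase_eq_of_notMem h]; omega
      have h2 : (F₀.image Prod.fst).card ≤ (F.image Prod.fst).card :=
        Finset.card_le_card (Finset.image_subset_image (Finset.erase_subset _ _))
      omega
  | v :: rest, hnd, j + 1, F, hF => by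
      have hv : v ∉ rest := (List.nodup_cons.1 hnd).1
      rw [stair_cons_succ] at hF
      set F₀ := F.erase (liftV u' v) with hF₀
      have hF₀sub : F₀ ⊆ stair u u' rest j := fun q hq => by
        have hq' := Finset.mem_erase.1 hq
        rcases Finset.mem_insert.1 (hF hq'.2) with h | h
        · exact absurd h hq'.1
        · exact h
      have ih := card_le_card_image_fst_add_one_of_subset_stair huu' rest (List.nodup_cons.1 hnd).2 j F₀ hF₀sub
      by_cases hmem : liftV u' v ∈ F
      · -- `v` is a new projection
        have hvimg : v ∉ F₀.image Prod.fst := by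
          intro h
          obtain ⟨q, hq, hqv⟩ := Finset.mem_image.1 h
          obtain ⟨w, hw, h' | h'⟩ := exists_of_mem_stair (hF₀sub hq)
          · rw [h', liftV_fst] at hqv; exact hv (hqv ▸ hw)
          · rw [h', liftV_fst] at hqv; exact hv (hqv ▸ hw)
        have himg : F.image Prod.fst = insert v (F₀.image Prod.fst) := by
          rw [hF₀, ← Finset.insert_erase hmem, Finset.image_insert, liftV_fst, Finset.insert_erase hmem]
        rw [himg, Finset.card_insert_of_notMem hvimg]
        have : F.card = F₀.card + 1 := by rw [hF₀, Finset.card_erase_add_one hmem]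
        omega
      · have hFF₀ : F₀ = F := Finset.erase_eq_of_notMem hmem
        rw [hFF₀] at ih
        exact ih

omit [NormedAddCommGroup W] [NormedSpace ℝ W] in
/-- **A face at one level has as many vertices as its projection.** [folklore] -/
theorem card_image_fst_eq_of_forall_snd_eq {F : Finset (W × ℝ)} {c : ℝ} (h : ∀ q ∈ F, q.2 = c) :
    (F.image Prod.fst).card = F.card :=
  Finset.card_image_of_injOn fun q hq q' hq' hqq' =>
    Prod.ext hqq' ((h q hq).trans (h q' hq').symm)

/-! ### Tracked pieces are unions of small fine faces -/

section Pieces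

variable {K K' : Geometry.SimplicialComplex ℝ W} {L' : List W} (hL' : L'.Nodup)
  (hKL' : ∀ σ ∈ K'.faces, σ ⊆ L'.toFinset)
  {t t' : ℕ → ℝ} (ht : StrictMono t) (ht' : StrictMono t') {N m : ℕ} (hm : 0 < m)
  (hsub' : ∀ a b : ℕ, b ≤ m → t' (m * a + b) = t a + (b : ℝ) / m * (t (a + 1) - t a))
  (hcov : ∀ τ ∈ K.faces, ∀ y ∈ convexHull ℝ (τ : Set W), ∃ τ' ∈ K'.faces,
    y ∈ convexHull ℝ (τ' : Set W) ∧ convexHull ℝ (τ' : Set W) ⊆ convexHull ℝ (τ : Set W))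

include hKL' in
/-- The vertices of a prism face project into the base simplex and lie at its two levels.
[folklore] -/
theorem image_fst_subset_and_levels_of_mem_prismFaces {σ : Finset W} (hσ : σ ∈ K'.faces) {c : ℕ}
    {F : Finset (W × ℝ)} (hF : F ∈ prismFaces (t' c) (t' (c + 1)) (faceList L' σ)) :
    F.image Prod.fst ⊆ σ ∧ ∀ q ∈ F, q.2 = t' c ∨ q.2 = t' (c + 1) := by
  constructor
  · intro w hw
    obtain ⟨q, hq, rfl⟩ := Finset.mem_image.1 hw
    obtain ⟨-, i, -, hFi⟩ := hF
    obtain ⟨w', hw', h | h⟩ := exists_of_mem_stair (hFi hq)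
    all_goals
      rw [h, liftV_fst]
      have : w' ∈ (faceList L' σ).toFinset := List.mem_toFinset.2 hw'
      rwa [faceList_toFinset (hKL' σ hσ)] at this
  · intro q hq
    obtain ⟨-, i, -, hFi⟩ := hF
    obtain ⟨w', -, h | h⟩ := exists_of_mem_stair (hFi hq)
    · rw [h]; exact Or.inl rfl
    · rw [h]; exact Or.inr rfl

include hL' hKL' ht ht' hm hsub' hcov in
/-- **Cell pieces are unions of small fine faces.** For `σ ∈ K` with `σ.card ≤ n - 3` and
`a < N`, every point of the coarse cell `conv σ × [t a, t (a + 1)]` lies in a closed face of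
the fine product complex, with at most `n - 2` vertices, contained in the cell. [folklore] -/
theorem exists_small_face_of_mem_prismCell_piece {n : ℕ} {σ : Finset W} (hσ : σ ∈ K.faces)
    (hcard : σ.card ≤ n - 3) {a : ℕ} (ha : a < N) {p : W × ℝ}
    (hp : p ∈ prismCell σ (t a) (t (a + 1))) :
    ∃ F ∈ productFaces K' L' t' (N * m), F.card ≤ n - 2 ∧ p ∈ convexHull ℝ (F : Set (W × ℝ)) ∧
      convexHull ℝ (F : Set (W × ℝ)) ⊆ prismCell σ (t a) (t (a + 1)) := by
  have h := prismCell_eq_biUnion (K := K) hL' hKL' ht ht' hm hsub' (N := N) hcov hσ ha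
  have hp' := hp
  rw [h] at hp'
  obtain ⟨F, ⟨hF, hFsub⟩, hpF⟩ := mem_iUnion₂.1 hp'
  refine ⟨F, hF, ?_, hpF, hFsub⟩
  obtain ⟨c, hc, σ', hσ', hFσ'⟩ := mem_productFaces_iff.1 hF
  obtain ⟨himg, -⟩ := image_fst_subset_and_levels_of_mem_prismFaces hKL' hσ' hFσ'
  -- the projection of `F` is a face of `K'` inside `conv σ`
  have hne : F.Nonempty := hFσ'.1
  have himgne : (F.image Prod.fst).Nonempty := hne.image _
  have hρ : F.image Prod.fst ∈ K'.faces := K'.down_closed hσ' himg himgne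
  have hρσ : convexHull ℝ ((F.image Prod.fst : Finset W) : Set W) ⊆ convexHull ℝ (σ : Set W) := by
    refine convexHull_min (fun w hw => ?_) (convex_convexHull ℝ _)
    obtain ⟨q, hq, rfl⟩ := Finset.mem_image.1 hw
    exact (hFsub (subset_convexHull ℝ _ (by exact_mod_cast hq))).1
  have h1 := card_le_of_convexHull_subset hρ hρσ
  obtain ⟨-, i, -, hFi⟩ := hFσ'
  have h2 := card_le_card_image_fst_add_one_of_subset_stair (ht' (Nat.lt_succ_self c)).ne
    (faceList L' σ') (faceList_nodup hL' σ') i F hFi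
  have h3 := (K.nonempty_of_mem_faces hσ).card_pos
  omega

include hKL' hm hsub' hcov in
/-- **Level pieces are unions of small fine faces.** For `σ ∈ K` with `σ.card ≤ n - 2` and
`a ≤ N`, `0 < N`, every point of the coarse level `conv σ × {t a}` lies in a closed face of the
fine product complex, with at most `n - 2` vertices, contained in the level. [folklore] -/
theorem exists_small_face_of_mem_prismLevel_piece {n : ℕ} {σ : Finset W} (hσ : σ ∈ K.faces)
    (hcard : σ.card ≤ n - 2) {a : ℕ} (ha : a ≤ N) (hN : 0 < N) {p : W × ℝ}
    (hp : p ∈ prismLevel σ (t a)) :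
    ∃ F ∈ productFaces K' L' t' (N * m), F.card ≤ n - 2 ∧ p ∈ convexHull ℝ (F : Set (W × ℝ)) ∧
      convexHull ℝ (F : Set (W × ℝ)) ⊆ prismLevel σ (t a) := by
  have h := prismLevel_eq_biUnion (K := K) hKL' hm hsub' (N := N) hcov hσ ha hN
  have hp' := hp
  rw [h] at hp'
  obtain ⟨F, ⟨hF, hFsub⟩, hpF⟩ := mem_iUnion₂.1 hp'
  refine ⟨F, hF, ?_, hpF, hFsub⟩
  obtain ⟨c, hc, σ', hσ', hFσ'⟩ := mem_productFaces_iff.1 hF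
  obtain ⟨himg, -⟩ := image_fst_subset_and_levels_of_mem_prismFaces hKL' hσ' hFσ'
  have hne : F.Nonempty := hFσ'.1
  have hρ : F.image Prod.fst ∈ K'.faces := K'.down_closed hσ' himg (hne.image _)
  have hρσ : convexHull ℝ ((F.image Prod.fst : Finset W) : Set W) ⊆ convexHull ℝ (σ : Set W) := by
    refine convexHull_min (fun w hw => ?_) (convex_convexHull ℝ _)
    obtain ⟨q, hq, rfl⟩ := Finset.mem_image.1 hw
    exact (hFsub (subset_convexHull ℝ _ (by exact_mod_cast hq))).1
  have h1 := card_le_of_convexHull_subset hρ hρσ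
  -- all vertices of `F` are at the level `t a`
  have hlev : ∀ q ∈ F, q.2 = t a := fun q hq => by
    have := (hFsub (subset_convexHull ℝ _ (by exact_mod_cast hq))).2
    exact mem_singleton_iff.1 this
  have h2 := card_image_fst_eq_of_forall_snd_eq hlev
  have h3 := (K.nonempty_of_mem_faces hσ).card_pos
  omega

end Pieces

/-! ### Equal subdivisions compose -/

/-- **Equal subdivisions compose**: if `t` is the equal `M`-subdivision of `s` and `t'` the equal
`m`-subdivision of `t`, then `t'` is the equal `M m`-subdivision of `s`. [folklore] -/
theorem subLevels_comp {s t t' : ℕ → ℝ} {M m : ℕ} (hM : 0 < M) (hm : 0 < m)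
    (ht : ∀ a b : ℕ, b ≤ M → t (M * a + b) = s a + (b : ℝ) / M * (s (a + 1) - s a))
    (ht' : ∀ c b : ℕ, b ≤ m → t' (m * c + b) = t c + (b : ℝ) / m * (t (c + 1) - t c)) :
    ∀ a k : ℕ, k ≤ M * m → t' (M * m * a + k) = s a + (k : ℝ) / (M * m : ℕ) * (s (a + 1) - s a) := by
  intro a k hk
  have hMr : (0 : ℝ) < M := by exact_mod_cast hM
  have hmr : (0 : ℝ) < m := by exact_mod_cast hm
  set b := k / m with hb
  set b' := k % m with hb'
  have hk' : k = m * b + b' := (Nat.div_add_mod k m).symm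
  have hb'm : b' < m := Nat.mod_lt k hm
  have hbM : b ≤ M := by
    rw [hb]
    calc k / m ≤ M * m / m := Nat.div_le_div_right hk
      _ = M := Nat.mul_div_cancel M hm
  rcases hbM.lt_or_eq with hbM | hbM
  · -- generic case
    have h1 : M * m * a + k = m * (M * a + b) + b' := by rw [hk']; ring
    rw [h1, ht' (M * a + b) b' hb'm.le, ht a b hbM.le, show M * a + b + 1 = M * a + (b + 1) by ring,
      ht a (b + 1) (Nat.succ_le_of_lt hbM)]
    rw [hk']
    push_cast
    field_simp
    ring
  · -- `b = M`: then `b' = 0` and `k = M m`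
    have hb'0 : b' = 0 := by
      have : m * b + b' ≤ M * m := hk' ▸ hk
      rw [hbM] at this
      nlinarith
    have hkMm : k = M * m := by rw [hk', hbM, hb'0]; ring
    have h1 : M * m * a + k = m * (M * (a + 1) + 0) + 0 := by rw [hkMm]; ring
    rw [h1, ht' (M * (a + 1) + 0) 0 (Nat.zero_le m), ht (a + 1) 0 (Nat.zero_le M), hkMm]
    have hMm : ((M * m : ℕ) : ℝ) ≠ 0 := by positivity
    push_cast
    field_simp
    ring

/-! ### Interior fine simplices against the facets of the block simplex -/

section Walls

variable {K K' : Geometry.SimplicialComplex ℝ W}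
  (hcov : ∀ τ ∈ K.faces, ∀ y ∈ convexHull ℝ (τ : Set W), ∃ τ' ∈ K'.faces,
    y ∈ convexHull ℝ (τ' : Set W) ∧ convexHull ℝ (τ' : Set W) ⊆ convexHull ℝ (τ : Set W))

include hcov in
/-- **An interior fine simplex meets a facet of the block simplex inside its own facets.** If
`τ ∈ K`, `v ∈ τ`, `τ' ∈ K'` with `conv τ' ⊄ conv (τ ∖ {v})`, then
`conv τ' ∩ conv (τ ∖ {v}) ⊆ ⋃_{w ∈ τ'} conv (τ' ∖ {w})`. [folklore] -/
theorem convexHull_inter_facet_subset_walls {τ : Finset W} (hτ : τ ∈ K.faces) {v : W}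
    {τ' : Finset W} (hτ' : τ' ∈ K'.faces)
    (hint : ¬ convexHull ℝ (τ' : Set W) ⊆ convexHull ℝ ((τ.erase v : Finset W) : Set W)) :
    convexHull ℝ (τ' : Set W) ∩ convexHull ℝ ((τ.erase v : Finset W) : Set W) ⊆
      ⋃ w ∈ τ', convexHull ℝ ((τ'.erase w : Finset W) : Set W) := by
  rintro x ⟨hxτ', hxf⟩
  by_cases hne : (τ.erase v).Nonempty
  · have hface : τ.erase v ∈ K.faces := K.down_closed hτ (Finset.erase_subset v τ) hne
    obtain ⟨τ'', hτ'', hxτ'', hτ''sub⟩ := hcov _ hface x hxf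
    -- `x ∈ conv (τ' ∩ τ'')`, a proper face of `τ'`
    have hxI : x ∈ convexHull ℝ ((τ' ∩ τ'' : Finset W) : Set W) := by
      rw [Finset.coe_inter, ← K'.convexHull_inter_convexHull hτ' hτ'']
      exact ⟨hxτ', hxτ''⟩
    have hproper : τ' ∩ τ'' ≠ τ' := fun h => hint (by
      have hsub : τ' ⊆ τ'' := Finset.inter_eq_left.1 h
      exact (convexHull_mono (by exact_mod_cast hsub)).trans hτ''sub)
    obtain ⟨w, hw, hwI⟩ : ∃ w ∈ τ', w ∉ τ' ∩ τ'' := by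
      by_contra h
      push Not at h
      exact hproper (Finset.Subset.antisymm Finset.inter_subset_left fun w hw => h w hw)
    refine mem_iUnion₂.2 ⟨w, hw, convexHull_mono ?_ hxI⟩
    intro y hy
    simp only [Finset.coe_inter, mem_inter_iff, Finset.mem_coe] at hy
    simp only [Finset.coe_erase, mem_sdiff, Finset.mem_coe, mem_singleton_iff]
    exact ⟨hy.1, fun h => hwI (h ▸ Finset.mem_inter.2 hy)⟩
  · rw [Finset.not_nonempty_iff_eq_empty] at hne
    rw [hne, Finset.coe_empty, convexHull_empty] at hxf
    exact absurd hxf (notMem_empty x)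

/-- **Two distinct fine simplices of the same cardinality meet inside the facets of either.**
[folklore] -/
theorem convexHull_inter_convexHull_subset_walls {τ₁ τ₂ : Finset W} (h₁ : τ₁ ∈ K'.faces)
    (h₂ : τ₂ ∈ K'.faces) (hne : τ₁ ≠ τ₂) (hcard : τ₁.card = τ₂.card) :
    convexHull ℝ (τ₁ : Set W) ∩ convexHull ℝ (τ₂ : Set W) ⊆
      ⋃ w ∈ τ₂, convexHull ℝ ((τ₂.erase w : Finset W) : Set W) := by
  rintro x ⟨hx₁, hx₂⟩
  have hxI : x ∈ convexHull ℝ ((τ₁ ∩ τ₂ : Finset W) : Set W) := by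
    rw [Finset.coe_inter, ← K'.convexHull_inter_convexHull h₁ h₂]
    exact ⟨hx₁, hx₂⟩
  have hproper : τ₁ ∩ τ₂ ≠ τ₂ := fun h => by
    have hsub : τ₂ ⊆ τ₁ := Finset.inter_eq_right.1 h
    exact hne (Finset.eq_of_subset_of_card_le hsub hcard.le).symm
  obtain ⟨w, hw, hwI⟩ : ∃ w ∈ τ₂, w ∉ τ₁ ∩ τ₂ := by
    by_contra h
    push Not at h
    exact hproper (Finset.Subset.antisymm Finset.inter_subset_right fun w hw => h w hw)
  refine mem_iUnion₂.2 ⟨w, hw, convexHull_mono ?_ hxI⟩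
  intro y hy
  simp only [Finset.coe_inter, mem_inter_iff, Finset.mem_coe] at hy
  simp only [Finset.coe_erase, mem_sdiff, Finset.mem_coe, mem_singleton_iff]
  exact ⟨hy.2, fun h => hwI (h ▸ Finset.mem_inter.2 hy)⟩

end Walls

end Literature.Topology.FourManifolds

end
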